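import Mathlib.Algebra.Polynomial.Reverse
import Literature.NumberTheory.Automorphic.GL2RSLFactorCharacter
import Literature.NumberTheory.Automorphic.GL2TorusEquivariantUniqueness
import Literature.NumberTheory.Automorphic.RankinSelbergLocalTwistProofs
import Literature.NumberTheory.Automorphic.RankinSelbergLocalEquiv
import Literature.NumberTheory.Automorphic.LocalLanglandsGLOne
import HarnessLib

/-!
# The local functional equation of `GL₂ × GL₁` (Jacquet–Langlands 1970, Thm. 2.18 (iv);
# Jacquet–Piatetski-Shapiro–Shalika 1983, Thm. 2.7 (iii) for `(n, m) = (2, 1)`)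

Topic `Literature/NumberTheory/Automorphic`; vocabulary of `RankinSelbergLocal` (`rsZeta`,
`rsZetaTilde`, `tildeFn`, `weylNM`, `HasRSGamma`, `HasRSLFactor`, `glOneRep`, `evalAtQ`,
`EqOnRightHalfPlane`, `EqOnLeftHalfPlane`, `dualVar`, `tateEpsilonRat`, the named fact
`existsUnique_hasRSGamma_haar`).  **Main result** (`existsUnique_hasRSGamma_haar_two_one`): the
literal `(n, m) = (2, 1)` instance of the named fact `existsUnique_hasRSGamma_haar` — for `π`, `π'`
irreducible admissible generic representations of `GL₂(F)`, `GL₁(F)` (spaces in `Type`), `ψ`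
continuous non-trivial, `ν` invariant on `GL₁(F) ⧸ U₁` and `μ` additive Haar, there is a unique
`γ(s, π × π', ψ) ∈ ℂ(q^{-s})` with `Ψ(1 - s; W̃, W̃') = ω_{π'}(-1) γ(s) Ψ(s; W, W')` for all Whittaker
data (`HasRSGamma`).  This is Jacquet–Langlands' Theorem 2.18 (iv) (LNM 114, p. 52 of the held
scan: "`Φ̃(w g, 1 - s, W̃)/L(1 - s, χ⁻¹ ⊗ π̃) = ε(s, χ ⊗ π, ψ) Φ(g, s, W)/L(s, χ ⊗ π)`") in the
`γ`-factor form of Jacquet–Piatetski-Shapiro–Shalika, Thm. 2.7 (iii) (Cogdell 2004, Thm. 6.2).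

## The proof (Bernstein's uniqueness principle over `K = ℂ(X)`, `X = q^{-s}`)

JPSS prove (iii) from the uniqueness of `GL_m`-quasi-invariant bilinear forms (op. cit. §2.10–2.11;
Cogdell §6.3); for `GL₂ × GL₁` this is the uniqueness of torus-equivariant functionals on the
Kirillov model, proved in `GL2TorusEquivariantUniqueness` (`torusEquivariant_proportional`:
`ℂ`-linear `Z : V → K` with `Z(π(d(b,1)) v) = e(b) Z(v)` form a `K`-line, Jacquet–Langlands
Props. 2.8–2.9 plus the finiteness of the Jacquet module).  Here:

* Part A — the substitution `σ : X ↦ q⁻¹X⁻¹` of `ℂ(X)` (`dualSubst`, Mathlib `RatFunc.liftAlgHom`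
  of the injective `aeval (q⁻¹X⁻¹)`), with `(σR)(q^{-(1-s)}) = R(q^{-s})` for `re s` large
  (`eventually_evalAtQ_dualSubst_one_sub`, via `reflect`) — it turns right half-planes in `s` into
  left half-planes in `1 - s` (`eqOnLeftHalfPlane_one_sub_dualSubst`).
* Part B — the shapes at `(2, 1)`: `w_{2,1} = 1`, `w_1 = 1`, no shear variables, `Ψ̃ = Ψ`
  (`rsZetaTilde_two_one`, for every `μ`).
* Part C — `Ψ(s; W_u, χ)` as the torus integral `∫ χ(a) W_u(d(a,1)) |a|^{s-1/2} d^×a`, its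
  quasi-invariance `Ψ(s; W_{π(d(b,1))u}, χ) = χ(b)⁻¹|b|^{1/2-s} Ψ(s; W_u, χ)` (all `s`), the same for
  the contragredient side written through the twist `π^ι = π ∘ ᵗ(·)⁻¹` (`tildeFn_whittakerModel`),
  absolute convergence for `re s` large (the gauge of `WhittakerTorusJacquetGL2`) and additivity.
* Part D — rational continuation `u ↦ R_u` is a `ℂ`-LINEAR map `V → ℂ(X)` (identity principle).
* Part E — `exists_gamma_glOneRep_whittakerModel_id`: the right functional `Zr` and the
  contragredient functional `Zt = σ ∘ Zr'` transform under `π(d(b,1))` by the same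
  `e(b) = χ(b)⁻¹ q^{-k/2} X^{-k}` (`|b| = q^{-k}`; `e = 1` on a deep `U^f`, `e(ϖ⁻¹) = c X`
  transcendental), hence `Zt = γ Zr` with `γ = Zt(w)/Zr(w)`, `Zr(w) = μ'(U^M) ≠ 0` for the test
  vector `w` of the uniqueness theorem.
* Part F — `HasRSGamma (1<2) π (glOneRep χ) ψ μ ν γ` (scaling in the Whittaker data by local
  multiplicity one, sign `ω(-1) = χ(-1)`), `∃!` by `HasRSGamma.existsUnique_of_exists`, and the
  general `π'` through `π' ≃ glOneRep χ` (`SmoothIrrep.existsUnique_quasiChar`,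
  `hasRSGamma_iff_of_equiv_right`).

## References

* H. Jacquet, R. P. Langlands, *Automorphic Forms on GL(2)*, LNM 114 (1970), Thm. 2.18 (iv),
  Props. 2.8–2.11. [JacquetLanglands1970]
* H. Jacquet, I. I. Piatetski-Shapiro, J. Shalika, *Rankin–Selberg convolutions*, Amer. J. Math.
  105 (1983), Thm. 2.7 (iii), §2.10–2.11. [JacquetPiatetskiShapiroShalika1983]
* J. W. Cogdell, *Lectures on `L`-functions, converse theorems, and functoriality for `GL_n`*,
  Fields Inst. Monogr. 20 (2004), §6.3, Thm. 6.2. [Cogdell2004]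
-/

set_option autoImplicit false

noncomputable section

open scoped MatrixGroups NNReal Polynomial nonZeroDivisors
open MeasureTheory ValuativeRel Polynomial Filter
  Literature.NumberTheory.GaloisRepresentations.IsNonarchimedeanLocalField
open Literature.NumberTheory.GaloisRepresentations (glTransposeInv)

namespace Literature.NumberTheory.Automorphic

/-! ### Part A: the substitution `X ↦ q⁻¹ X⁻¹` of `ℂ(X)` -/

section Subst

variable (F : Type*) [Field F] [ValuativeRel F] [TopologicalSpace F] [IsNonarchimedeanLocalField F]

/-- `reflect B f` has degree `≤ B` when `deg f ≤ B`. [folklore] -/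
theorem natDegree_reflect_le' {f : ℂ[X]} {B : ℕ} (hf : f.natDegree ≤ B) :
    (reflect B f).natDegree ≤ B := by
  refine Polynomial.natDegree_le_iff_coeff_eq_zero.2 fun i hi => ?_
  have hi' : B < i := by exact_mod_cast hi
  rw [coeff_reflect, revAt, Function.Embedding.coeFn_mk]
  simp only [not_le.2 hi', if_false]
  exact Polynomial.coeff_eq_zero_of_natDegree_lt (hf.trans_lt hi')

/-- `q⁻¹ X⁻¹ = (q X)⁻¹` and `q X ≠ 0` in `ℂ(X)`. [folklore] -/
theorem dualVar_eq_inv :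
    dualVar F = (RatFunc.C (residueFieldCard F : ℂ) * RatFunc.X)⁻¹ := by
  rw [dualVar, mul_inv, ← map_inv₀]

/-- `q X ≠ 0` in `ℂ(X)`. [folklore] -/
theorem ratFuncC_mul_X_ne_zero : (RatFunc.C (residueFieldCard F : ℂ) * RatFunc.X : RatFunc ℂ) ≠ 0 :=
  mul_ne_zero (by rw [Ne, map_eq_zero]; exact_mod_cast residueFieldCard_ne_zero F) RatFunc.X_ne_zero

/-- **`f(q⁻¹X⁻¹) (qX)^B = (reflect_B f)(qX)`** for `deg f ≤ B` (Mathlib `eval₂_reflect_mul_pow`).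
[folklore] -/
theorem aeval_dualVar_mul_pow (f : ℂ[X]) {B : ℕ} (hf : f.natDegree ≤ B) :
    aeval (dualVar F) f * (RatFunc.C (residueFieldCard F : ℂ) * RatFunc.X) ^ B =
      algebraMap ℂ[X] (RatFunc ℂ) ((reflect B f).comp (C (residueFieldCard F : ℂ) * X)) := by
  set x : RatFunc ℂ := RatFunc.C (residueFieldCard F : ℂ) * RatFunc.X with hx
  letI : Invertible x := invertibleOfNonzero (ratFuncC_mul_X_ne_zero F)
  have h := eval₂_reflect_mul_pow (algebraMap ℂ (RatFunc ℂ)) x B (reflect B f)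
    (natDegree_reflect_le' hf)
  rw [reflect_reflect, invOf_eq_inv] at h
  have hd : dualVar F = x⁻¹ := dualVar_eq_inv F
  rw [aeval_def, hd, h]
  have hx' : x = algebraMap ℂ[X] (RatFunc ℂ) (C (residueFieldCard F : ℂ) * X) := by
    rw [hx, map_mul, RatFunc.algebraMap_C, RatFunc.algebraMap_X]
  rw [hx', ← Polynomial.aeval_def, Polynomial.aeval_algebraMap_apply, ← Polynomial.comp_eq_aeval]

/-- `f(q⁻¹X⁻¹) ≠ 0` for `f ≠ 0`: `q⁻¹ X⁻¹` is transcendental over `ℂ`. [folklore] -/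
theorem aeval_dualVar_ne_zero_of_ne_zero {f : ℂ[X]} (hf : f ≠ 0) : aeval (dualVar F) f ≠ 0 := by
  intro h
  have h1 := aeval_dualVar_mul_pow F f le_rfl
  rw [h, zero_mul, eq_comm, map_eq_zero_iff _ (RatFunc.algebraMap_injective ℂ),
    Polynomial.comp_eq_zero_iff] at h1
  rcases h1 with h1 | ⟨-, h1⟩
  · exact hf (reflect_eq_zero_iff.1 h1)
  · have h2 := congrArg natDegree h1
    rw [natDegree_C, natDegree_C_mul_X _ (by exact_mod_cast residueFieldCard_ne_zero F)] at h2
    exact one_ne_zero h2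

/-- `aeval (q⁻¹X⁻¹)` is injective on `ℂ[X]`. [folklore] -/
theorem aeval_dualVar_injective :
    Function.Injective (aeval (dualVar F) : ℂ[X] →ₐ[ℂ] RatFunc ℂ) := by
  refine (injective_iff_map_eq_zero _).2 fun f hf => ?_
  by_contra h
  exact aeval_dualVar_ne_zero_of_ne_zero F h hf

/-- **The substitution `σ : R(X) ↦ R(q⁻¹ X⁻¹)`** of the field `ℂ(X)` (a `ℂ`-algebra
endomorphism; on `X = q^{-s}` it is `s ↦ 1 - s`), built with Mathlib's `RatFunc.liftAlgHom` from
the injective `aeval (q⁻¹X⁻¹)`. [folklore] -/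
def dualSubst : RatFunc ℂ →ₐ[ℂ] RatFunc ℂ :=
  RatFunc.liftAlgHom (aeval (dualVar F))
    (nonZeroDivisors_le_comap_nonZeroDivisors_of_injective _ (aeval_dualVar_injective F))

/-- `σ(p / q) = p(q⁻¹X⁻¹) / q(q⁻¹X⁻¹)` for polynomials `p`, `q`. [folklore] -/
theorem dualSubst_div (p q : ℂ[X]) :
    dualSubst F (algebraMap ℂ[X] (RatFunc ℂ) p / algebraMap ℂ[X] (RatFunc ℂ) q) =
      aeval (dualVar F) p / aeval (dualVar F) q :=
  RatFunc.liftAlgHom_apply_div _ _ p q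

/-- `σ(p) = p(q⁻¹X⁻¹)` for a polynomial `p`. [folklore] -/
theorem dualSubst_algebraMap (p : ℂ[X]) :
    dualSubst F (algebraMap ℂ[X] (RatFunc ℂ) p) = aeval (dualVar F) p := by
  have h := dualSubst_div F p 1
  rwa [map_one, div_one, map_one, div_one] at h

/-- `σ(X) = q⁻¹ X⁻¹`. [folklore] -/
theorem dualSubst_X : dualSubst F RatFunc.X = dualVar F := by
  rw [← RatFunc.algebraMap_X, dualSubst_algebraMap, aeval_X]

/-- `σ(c) = c`. [folklore] -/
theorem dualSubst_C (c : ℂ) : dualSubst F (RatFunc.C c) = RatFunc.C c := by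
  have h := dualSubst_algebraMap F (C c)
  rwa [aeval_C, RatFunc.algebraMap_C, RatFunc.algebraMap_eq_C] at h

/-- **`σ` on the `ε`-monomials**: `σ(e X^a) = e q^{-a} X^{-a}`. [folklore] -/
theorem dualSubst_tateEpsilonRat (e : ℂ) (a : ℤ) :
    dualSubst F (tateEpsilonRat e a) =
      tateEpsilonRat (e * ((residueFieldCard F : ℂ)⁻¹) ^ a) (-a) := by
  rw [tateEpsilonRat, tateEpsilonRat, map_mul, dualSubst_C, map_zpow₀, dualSubst_X, dualVar, mul_zpow,
    ← map_zpow₀, inv_zpow' RatFunc.X a, map_mul, mul_assoc]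

/-- `q · q^{-(1-s)} = (q^{-s})⁻¹`. [folklore] -/
theorem natCast_mul_cpow_neg_one_sub {q : ℕ} (hq : q ≠ 0) (s : ℂ) :
    (q : ℂ) * (q : ℂ) ^ (-(1 - s)) = ((q : ℂ) ^ (-s))⁻¹ := by
  have hq' : (q : ℂ) ≠ 0 := Nat.cast_ne_zero.2 hq
  rw [show -(1 - s) = s + (-1 : ℂ) by ring, Complex.cpow_add _ _ hq', Complex.cpow_neg_one,
    mul_left_comm, mul_inv_cancel₀ hq', mul_one, Complex.cpow_neg, inv_inv]

/-- `(reflect_B f)(T⁻¹) = f(T) / T^B` for `T ≠ 0`. [folklore] -/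
theorem eval_inv_reflect {f : ℂ[X]} {B : ℕ} (hf : f.natDegree ≤ B) {T : ℂ} (hT : T ≠ 0) :
    (reflect B f).eval T⁻¹ = f.eval T / T ^ B := by
  letI : Invertible T := invertibleOfNonzero hT
  have h := eval₂_reflect_mul_pow (RingHom.id ℂ) T B f hf
  rw [invOf_eq_inv, eval₂_id, eval₂_id] at h
  rw [eq_div_iff (pow_ne_zero B hT), h]

/-- **`σ` is `s ↦ 1 - s` on `X = q^{-s}`**: `(σR)(q^{-(1-s)}) = R(q^{-s})` for `re s` large (off
the poles of `R`). [folklore] -/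
theorem eventually_evalAtQ_dualSubst_one_sub (R : RatFunc ℂ) :
    ∀ᶠ s in rightHalfPlanes,
      evalAtQ (residueFieldCard F) (dualSubst F R) (1 - s) = evalAtQ (residueFieldCard F) R s := by
  set q : ℕ := residueFieldCard F with hq_def
  have hq : 1 < q := one_lt_residueFieldCard F
  have hq0 : q ≠ 0 := by omega
  set B : ℕ := max R.num.natDegree R.denom.natDegree with hB
  set x : RatFunc ℂ := RatFunc.C (q : ℂ) * RatFunc.X with hx
  have hxB : x ^ B ≠ 0 := pow_ne_zero B (ratFuncC_mul_X_ne_zero F)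
  set N : ℂ[X] := (reflect B R.num).comp (C (q : ℂ) * X) with hN
  set D : ℂ[X] := (reflect B R.denom).comp (C (q : ℂ) * X) with hD
  -- `σ R = N / D`
  have hσ : dualSubst F R = algebraMap ℂ[X] (RatFunc ℂ) N / algebraMap ℂ[X] (RatFunc ℂ) D := by
    conv_lhs => rw [← RatFunc.num_div_denom R]
    rw [dualSubst_div, ← aeval_dualVar_mul_pow F R.num (le_max_left _ _),
      ← aeval_dualVar_mul_pow F R.denom (le_max_right _ _), mul_div_mul_right _ _ hxB]
  filter_upwards [eventually_eval_qpow_ne_zero hq (RatFunc.denom_ne_zero R)] with s hden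
  set T : ℂ := (q : ℂ) ^ (-s) with hT
  have hT0 : T ≠ 0 := natCast_cpow_neg_ne_zero (by omega) s
  have hqT : (q : ℂ) * (q : ℂ) ^ (-(1 - s)) = T⁻¹ := natCast_mul_cpow_neg_one_sub hq0 s
  have hNev : N.eval ((q : ℂ) ^ (-(1 - s))) = R.num.eval T / T ^ B := by
    rw [hN, eval_comp, eval_mul, eval_C, eval_X, hqT, eval_inv_reflect (le_max_left _ _) hT0]
  have hDev : D.eval ((q : ℂ) ^ (-(1 - s))) = R.denom.eval T / T ^ B := by
    rw [hD, eval_comp, eval_mul, eval_C, eval_X, hqT, eval_inv_reflect (le_max_right _ _) hT0]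
  have hDne : D.eval ((q : ℂ) ^ (-(1 - s))) ≠ 0 := by
    rw [hDev]
    exact div_ne_zero hden (pow_ne_zero B hT0)
  rw [hσ, evalAtQ_div_of_eval_ne_zero q N D hDne, hNev, hDev,
    div_div_div_cancel_right₀ (pow_ne_zero B hT0)]
  rw [evalAtQ, RatFunc.eval, eval₂_id, eval₂_id]

/-- **From the right half-plane in `s` to the left half-plane in `1 - s`.**  If
`Z(s) = R(q^{-s})` for `re s` large then `Z(1 - s) = (σR)(q^{-s})` for `re s` small. [folklore] -/
theorem eqOnLeftHalfPlane_one_sub_dualSubst {Z : ℂ → ℂ} {R : RatFunc ℂ}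
    (h : EqOnRightHalfPlane (residueFieldCard F) Z R) :
    EqOnLeftHalfPlane (residueFieldCard F) (fun s => Z (1 - s)) (dualSubst F R) := by
  have h' : ∀ᶠ s in rightHalfPlanes, Z s = evalAtQ (residueFieldCard F) (dualSubst F R) (1 - s) := by
    filter_upwards [eqOnRightHalfPlane_iff.1 h, eventually_evalAtQ_dualSubst_one_sub F R] with s h1 h2
    rw [h1, h2]
  obtain ⟨c, hc⟩ := eventually_rightHalfPlanes_iff.1 h'
  refine ⟨1 - c, fun s hs => ?_⟩
  have h1 := hc (1 - s) (by rw [Complex.sub_re, Complex.one_re]; linarith)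
  simp only [sub_sub_cancel] at h1
  exact h1

end Subst

/-! ### Part B: the shapes of the `(2, 1)` functional equation -/

section Shapes

variable {R : Type*} [CommRing R]

/-- `w_{2,1} = diag(1_1, w_1) = 1`. [folklore] -/
theorem weylNM_one_two : weylNM R (Nat.one_lt_two).le = 1 := by
  haveI : Subsingleton (Fin (2 - 1)) := inferInstanceAs (Subsingleton (Fin 1))
  have hperm : (finBlockEquiv (Nat.one_lt_two).le).permCongr
      (Equiv.sumCongr (Equiv.refl (Fin 1)) Fin.revPerm) = Equiv.refl (Fin 2) := by
    ext i : 1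
    obtain ⟨x, rfl⟩ := (finBlockEquiv (Nat.one_lt_two).le).surjective i
    rcases x with a | b
    · simp only [Equiv.permCongr_apply, Equiv.symm_apply_apply, Equiv.sumCongr_apply, Sum.map_inl,
        Equiv.refl_apply]
    · simp only [Equiv.permCongr_apply, Equiv.symm_apply_apply, Equiv.sumCongr_apply, Sum.map_inr,
        Fin.revPerm_apply, Equiv.refl_apply]
      congr 2
      exact Subsingleton.elim _ _
  unfold weylNM
  rw [hperm]
  exact map_one _

/-- `w_1 = 1`. [folklore] -/
theorem weylLong_one : weylLong 1 R = 1 := by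
  unfold weylLong
  rw [show (Fin.revPerm : Equiv.Perm (Fin 1)) = 1 from Subsingleton.elim _ _]
  exact map_one _

/-- In corank one the shear matrix `X(x)`, `x ∈ M_{0×1}`, vanishes (no rows). [folklore] -/
theorem lowerShearMatrix_two_one (x : Fin (2 - 1 - 1) → Fin 1 → R) : lowerShearMatrix 2 1 x = 0 := by
  ext i j
  simp only [lowerShearMatrix, Matrix.of_apply, Matrix.zero_apply]
  split_ifs with hi
  · exfalso
    omega
  · rfl
  · rfl

/-- In corank one the unipotent shear `u(x) = 1 + X(x)` is `1`. [folklore] -/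
theorem lowerShear_two_one (x : Fin (2 - 1 - 1) → Fin 1 → R) : lowerShear 2 1 x = 1 :=
  Units.ext (by rw [coe_lowerShear, lowerShearMatrix_two_one, add_zero, Units.val_one])

variable {F : Type*} [Field F] [ValuativeRel F] [TopologicalSpace F] [IsNonarchimedeanLocalField F]
  [MeasurableSpace (GL (Fin 1) F ⧸ upperUnitriangular (Fin 1) F)]

/-- **`Ψ̃ = Ψ` for `GL₂ × GL₁`**: the modified zeta integral `Ψ_{n-m-1} = Ψ_0` has no shear
variables, so `rsZetaTilde (1<2) μ ν W W' s = rsZeta (1<2) ν W W' s` for EVERY measure `μ`.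
[folklore] -/
theorem rsZetaTilde_two_one [MeasurableSpace F] (μ : Measure F)
    (ν : Measure (GL (Fin 1) F ⧸ upperUnitriangular (Fin 1) F))
    (W : GL (Fin 2) F → ℂ) (W' : GL (Fin 1) F → ℂ) (s : ℂ) :
    rsZetaTilde Nat.one_lt_two μ ν W W' s = rsZeta Nat.one_lt_two ν W W' s := by
  haveI : IsEmpty (Fin (2 - 1 - 1)) := inferInstanceAs (IsEmpty (Fin 0))
  have hpi : (Measure.pi fun _ : Fin (2 - 1 - 1) => Measure.pi fun _ : Fin 1 => μ) =
      Measure.dirac (fun a => isEmptyElim a) := Measure.pi_of_empty _ _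
  unfold rsZetaTilde
  congr 1
  funext y
  rw [hpi, integral_dirac, lowerShear_two_one, mul_one]

end Shapes

/-! ### Part C: the `GL₂ × GL₁` zeta integrals as torus integrals; quasi-invariance -/

section Torus

variable {F : Type*} [Field F] [ValuativeRel F] [TopologicalSpace F] [IsNonarchimedeanLocalField F]
  {V : Type*} [AddCommGroup V] [Module ℂ V] (π : Representation ℂ (GL (Fin 2) F) V)

omit [ValuativeRel F] [IsNonarchimedeanLocalField F] in
/-- `ᵗd(b, 1)⁻¹ = d(b⁻¹, 1)`. [folklore] -/
theorem glTransposeInv_diagGL2_one (b : Fˣ) :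
    glTransposeInv (Fin 2) F (diagGL2 b 1) = diagGL2 b⁻¹ 1 := by
  refine Units.ext ?_
  rw [Literature.NumberTheory.GaloisRepresentations.coe_glTransposeInv_apply, diagGL2_inv_one]
  simp only [coe_diagGL2]
  ext i j
  fin_cases i <;> fin_cases j <;> rfl

omit [ValuativeRel F] [IsNonarchimedeanLocalField F] in
/-- `det ᵗg⁻¹ = (det g)⁻¹`. [folklore] -/
private theorem det_glTransposeInv_aux {k : ℕ} (g : GL (Fin k) F) :
    Matrix.GeneralLinearGroup.det (glTransposeInv (Fin k) F g) = (Matrix.GeneralLinearGroup.det g)⁻¹ := by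
  refine Units.ext ?_
  rw [Matrix.GeneralLinearGroup.val_det_apply,
    Literature.NumberTheory.GaloisRepresentations.coe_glTransposeInv_apply, Matrix.det_transpose,
    ← Matrix.GeneralLinearGroup.val_det_apply, map_inv]

omit [ValuativeRel F] [IsNonarchimedeanLocalField F] in
/-- **`(χ ∘ det)^ι = χ⁻¹ ∘ det` on `GL₁`.** [folklore] -/
theorem glOneRep_comp_glTransposeInv (χ : Fˣ →* ℂˣ) :
    (glOneRep χ).comp (glTransposeInv (Fin 1) F).toMonoidHom = glOneRep χ⁻¹ := by
  refine MonoidHom.ext fun g => LinearMap.ext fun v => ?_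
  change (glOneRep χ) (glTransposeInv (Fin 1) F g) v = (glOneRep χ⁻¹) g v
  simp only [glOneRep, MonoidHom.coe_mk, OneHom.coe_mk, det_glTransposeInv_aux, map_inv,
    MonoidHom.inv_apply]

variable [MeasurableSpace F] [BorelSpace F]
  [MeasurableSpace (GL (Fin 1) F ⧸ upperUnitriangular (Fin 1) F)]

/-- **`Ψ(s; W_u, χ)` as a torus integral**: for the invariant measure `ν` transported from a Haar
measure `μ'` of `Fˣ`,
`Ψ(s; W_u, W'_{χ}) = ∫_{Fˣ} χ(a) W_u(d(a,1)) Λ'(v') |a|^{s-1/2} dμ'(a)`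
(`rsZeta_glOneRep_eq_rsZeta_twist`, `rsZeta_eq_integral_torus`). [folklore] -/
theorem rsZeta_glOneRep_eq_integral (μ' : Measure Fˣ) [μ'.IsHaarMeasure]
    (ν : Measure (GL (Fin 1) F ⧸ upperUnitriangular (Fin 1) F))
    (hint : ∀ f : GL (Fin 1) F ⧸ upperUnitriangular (Fin 1) F → ℂ,
      ∫ x, f x ∂ν = ∫ a : Fˣ, f (QuotientGroup.mk (glDiagonal 1 F fun _ => a)) ∂μ')
    (χ : Fˣ →* ℂˣ) (Λ : Module.Dual ℂ V) (u : V) (Λ' : Module.Dual ℂ ℂ) (v' : ℂ) (s : ℂ) :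
    rsZeta Nat.one_lt_two ν (whittakerModel π Λ u) (whittakerModel (glOneRep χ) Λ' v') s =
      ∫ a : Fˣ, ((χ a : ℂˣ) : ℂ) * whittakerModel π Λ u (diagGL2 a 1) * Λ' v' *
        (((normAbs F (a : F) : ℝ≥0) : ℝ) : ℂ) ^ (s - 1 / 2) ∂μ' := by
  set c : GL (Fin 2) F →* ℂˣ := χ.comp Matrix.GeneralLinearGroup.det with hc_def
  have hc : ∀ g, c g = χ (Matrix.GeneralLinearGroup.det g) := fun g => rfl
  have hW' : ∀ g, whittakerModel (Representation.trivial ℂ (GL (Fin 1) F) ℂ) Λ' v' g = Λ' v' :=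
    fun g => whittakerModel_trivial_apply _ _ g
  rw [rsZeta_glOneRep_eq_rsZeta_twist π ν hc, rsZeta_eq_integral_torus μ' ν hint _ hW' s]
  refine integral_congr_ae (Filter.Eventually.of_forall fun a => ?_)
  simp only
  rw [whittakerModel_twist_det π χ c hc, det_diagGL2_one_eq]

/-- `Ψ` is homogeneous in the vector: `Ψ(s; W_{c u}, χ) = c Ψ(s; W_u, χ)` (all `s`). [folklore] -/
theorem rsZeta_glOneRep_smul (μ' : Measure Fˣ) [μ'.IsHaarMeasure]
    (ν : Measure (GL (Fin 1) F ⧸ upperUnitriangular (Fin 1) F))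
    (hint : ∀ f : GL (Fin 1) F ⧸ upperUnitriangular (Fin 1) F → ℂ,
      ∫ x, f x ∂ν = ∫ a : Fˣ, f (QuotientGroup.mk (glDiagonal 1 F fun _ => a)) ∂μ')
    (χ : Fˣ →* ℂˣ) (Λ : Module.Dual ℂ V) (c : ℂ) (u : V) (Λ' : Module.Dual ℂ ℂ) (v' : ℂ) (s : ℂ) :
    rsZeta Nat.one_lt_two ν (whittakerModel π Λ (c • u)) (whittakerModel (glOneRep χ) Λ' v') s =
      c * rsZeta Nat.one_lt_two ν (whittakerModel π Λ u) (whittakerModel (glOneRep χ) Λ' v') s := by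
  rw [rsZeta_glOneRep_eq_integral π μ' ν hint, rsZeta_glOneRep_eq_integral π μ' ν hint,
    ← integral_const_mul]
  refine integral_congr_ae (Filter.Eventually.of_forall fun a => ?_)
  simp only [map_smul, Pi.smul_apply, smul_eq_mul]
  ring

/-- `Ψ` is homogeneous in the Whittaker functional: `Ψ(s; W^{cΛ}_u, χ) = c Ψ(s; W^Λ_u, χ)`. [folklore] -/
theorem rsZeta_glOneRep_smul_functional (μ' : Measure Fˣ) [μ'.IsHaarMeasure]
    (ν : Measure (GL (Fin 1) F ⧸ upperUnitriangular (Fin 1) F))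
    (hint : ∀ f : GL (Fin 1) F ⧸ upperUnitriangular (Fin 1) F → ℂ,
      ∫ x, f x ∂ν = ∫ a : Fˣ, f (QuotientGroup.mk (glDiagonal 1 F fun _ => a)) ∂μ')
    (χ : Fˣ →* ℂˣ) (Λ : Module.Dual ℂ V) (c : ℂ) (u : V) (Λ' : Module.Dual ℂ ℂ) (v' : ℂ) (s : ℂ) :
    rsZeta Nat.one_lt_two ν (whittakerModel π (c • Λ) u) (whittakerModel (glOneRep χ) Λ' v') s =
      c * rsZeta Nat.one_lt_two ν (whittakerModel π Λ u) (whittakerModel (glOneRep χ) Λ' v') s := by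
  rw [rsZeta_glOneRep_eq_integral π μ' ν hint, rsZeta_glOneRep_eq_integral π μ' ν hint,
    ← integral_const_mul]
  refine integral_congr_ae (Filter.Eventually.of_forall fun a => ?_)
  simp only [whittakerModel_apply, LinearMap.smul_apply, smul_eq_mul]
  ring

/-- `Ψ` is homogeneous in the `GL₁`-datum: `Ψ(s; W_u, W'_{Λ', v'}) = Λ'(v') Ψ(s; W_u, W'_{id, 1})`.
[folklore] -/
theorem rsZeta_glOneRep_eq_mul_rsZeta_id (μ' : Measure Fˣ) [μ'.IsHaarMeasure]
    (ν : Measure (GL (Fin 1) F ⧸ upperUnitriangular (Fin 1) F))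
    (hint : ∀ f : GL (Fin 1) F ⧸ upperUnitriangular (Fin 1) F → ℂ,
      ∫ x, f x ∂ν = ∫ a : Fˣ, f (QuotientGroup.mk (glDiagonal 1 F fun _ => a)) ∂μ')
    (χ : Fˣ →* ℂˣ) (Λ : Module.Dual ℂ V) (u : V) (Λ' : Module.Dual ℂ ℂ) (v' : ℂ) (s : ℂ) :
    rsZeta Nat.one_lt_two ν (whittakerModel π Λ u) (whittakerModel (glOneRep χ) Λ' v') s =
      Λ' v' * rsZeta Nat.one_lt_two ν (whittakerModel π Λ u)
        (whittakerModel (glOneRep χ) LinearMap.id 1) s := by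
  rw [rsZeta_glOneRep_eq_integral π μ' ν hint, rsZeta_glOneRep_eq_integral π μ' ν hint,
    ← integral_const_mul]
  refine integral_congr_ae (Filter.Eventually.of_forall fun a => ?_)
  simp only [LinearMap.id_apply]
  ring

omit [MeasurableSpace F] [BorelSpace F] [MeasurableSpace (GL (Fin 1) F ⧸ upperUnitriangular (Fin 1) F)] in
/-- `|a b⁻¹|^z = |a|^z |b|^{-z}` in `ℂ`. [folklore] -/
theorem normAbs_mul_inv_cpow (a b : Fˣ) (z : ℂ) :
    (((normAbs F ((a * b⁻¹ : Fˣ) : F) : ℝ≥0) : ℝ) : ℂ) ^ z =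
      (((normAbs F (a : F) : ℝ≥0) : ℝ) : ℂ) ^ z * (((normAbs F (b : F) : ℝ≥0) : ℝ) : ℂ) ^ (-z) := by
  have hb : (0 : ℝ) < ((normAbs F (b : F) : ℝ≥0) : ℝ) := by exact_mod_cast normAbs_units_pos b
  rw [Units.val_mul, Units.val_inv_eq_inv_val, map_mul, map_inv₀, NNReal.coe_mul, NNReal.coe_inv,
    Complex.ofReal_mul, Complex.mul_cpow_ofReal_nonneg (NNReal.coe_nonneg _) (inv_nonneg.2 hb.le),
    Complex.ofReal_inv, Complex.inv_cpow _ _ ?_, Complex.cpow_neg]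
  rw [Complex.arg_ofReal_of_nonneg hb.le]
  exact Real.pi_ne_zero.symm

/-- **Quasi-invariance of `Ψ` under the torus** (Cogdell 2004, §6.3 (i); JPSS 1983, §2.7):
`Ψ(s; W_{π(d(b,1)) u}, χ) = χ(b)⁻¹ |b|^{-(s - 1/2)} Ψ(s; W_u, χ)` for ALL `s` (the substitution
`a ↦ a b⁻¹` in the Haar integral). [cite: Cogdell2004, §6.3] -/
theorem rsZeta_glOneRep_diagGL2 (μ' : Measure Fˣ) [μ'.IsHaarMeasure]
    (ν : Measure (GL (Fin 1) F ⧸ upperUnitriangular (Fin 1) F))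
    (hint : ∀ f : GL (Fin 1) F ⧸ upperUnitriangular (Fin 1) F → ℂ,
      ∫ x, f x ∂ν = ∫ a : Fˣ, f (QuotientGroup.mk (glDiagonal 1 F fun _ => a)) ∂μ')
    (χ : Fˣ →* ℂˣ) (Λ : Module.Dual ℂ V) (u : V) (Λ' : Module.Dual ℂ ℂ) (v' : ℂ) (b : Fˣ) (s : ℂ) :
    rsZeta Nat.one_lt_two ν (whittakerModel π Λ (π (diagGL2 b 1) u))
        (whittakerModel (glOneRep χ) Λ' v') s =
      ((χ b : ℂˣ) : ℂ)⁻¹ * (((normAbs F (b : F) : ℝ≥0) : ℝ) : ℂ) ^ (-(s - 1 / 2)) *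
        rsZeta Nat.one_lt_two ν (whittakerModel π Λ u) (whittakerModel (glOneRep χ) Λ' v') s := by
  haveI : T2Space F :=
    (Literature.NumberTheory.GaloisRepresentations.IsNonarchimedeanLocalField.isLocalField F).toT2Space
  haveI : BorelSpace Fˣ := Units.borelSpace
  rw [rsZeta_glOneRep_eq_integral π μ' ν hint, rsZeta_glOneRep_eq_integral π μ' ν hint,
    ← integral_const_mul]
  set f : Fˣ → ℂ := fun x => ((χ (x * b⁻¹) : ℂˣ) : ℂ) * whittakerModel π Λ u (diagGL2 x 1) * Λ' v' *
    (((normAbs F ((x * b⁻¹ : Fˣ) : F) : ℝ≥0) : ℝ) : ℂ) ^ (s - 1 / 2) with hf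
  have h1 : (fun a : Fˣ => ((χ a : ℂˣ) : ℂ) * whittakerModel π Λ (π (diagGL2 b 1) u) (diagGL2 a 1) *
      Λ' v' * (((normAbs F (a : F) : ℝ≥0) : ℝ) : ℂ) ^ (s - 1 / 2)) = fun a => f (b * a) := by
    funext a
    rw [hf]
    simp only
    rw [whittakerModel_diagGL2_diagGL2, mul_comm b a, mul_inv_cancel_right]
  rw [h1, integral_mul_left_eq_self f b]
  refine integral_congr_ae (Filter.Eventually.of_forall fun a => ?_)
  rw [hf]
  simp only
  rw [map_mul, map_inv, Units.val_mul, Units.val_inv_eq_inv_val, normAbs_mul_inv_cpow]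
  ring

omit [MeasurableSpace F] [BorelSpace F] in
/-- **The contragredient side in Whittaker-model form**: for `GL₂ × GL₁`,
`Ψ(s'; W̃_u, W̃'_{χ}) = Ψ(s'; W^{π^ι}_{Λ∘π(w₂), u}, W'_{χ⁻¹})` with `π^ι = π ∘ ᵗ(·)⁻¹`
(`tildeFn_whittakerModel`, `w_1 = 1`, `(χ∘det)^ι = χ⁻¹∘det`). [folklore] -/
theorem rsZeta_tildeFn_glOneRep (ν : Measure (GL (Fin 1) F ⧸ upperUnitriangular (Fin 1) F))
    (χ : Fˣ →* ℂˣ) (Λ : Module.Dual ℂ V) (u : V) (Λ' : Module.Dual ℂ ℂ) (v' : ℂ) (s' : ℂ) :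
    rsZeta Nat.one_lt_two ν (tildeFn (whittakerModel π Λ u))
        (tildeFn (whittakerModel (glOneRep χ) Λ' v')) s' =
      rsZeta Nat.one_lt_two ν
        (whittakerModel (π.comp (glTransposeInv (Fin 2) F).toMonoidHom) (Λ.comp (π (weylLong 2 F))) u)
        (whittakerModel (glOneRep χ⁻¹) Λ' v') s' := by
  rw [tildeFn_whittakerModel, tildeFn_whittakerModel, glOneRep_comp_glTransposeInv, weylLong_one,
    map_one, Module.End.one_eq_id, LinearMap.comp_id]

/-- **Quasi-invariance of the contragredient side**:
`Ψ(s'; W̃_{π(d(b,1)) u}, W̃'_χ) = χ(b)⁻¹ |b|^{s' - 1/2} Ψ(s'; W̃_u, W̃'_χ)` for all `s'`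
(`π(d(b,1)) = π^ι(d(b⁻¹,1))` and `rsZeta_glOneRep_diagGL2` for `(π^ι, χ⁻¹, b⁻¹)`).
[cite: Cogdell2004, §6.3] -/
theorem rsZeta_tildeFn_glOneRep_diagGL2 (μ' : Measure Fˣ) [μ'.IsHaarMeasure]
    (ν : Measure (GL (Fin 1) F ⧸ upperUnitriangular (Fin 1) F))
    (hint : ∀ f : GL (Fin 1) F ⧸ upperUnitriangular (Fin 1) F → ℂ,
      ∫ x, f x ∂ν = ∫ a : Fˣ, f (QuotientGroup.mk (glDiagonal 1 F fun _ => a)) ∂μ')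
    (χ : Fˣ →* ℂˣ) (Λ : Module.Dual ℂ V) (u : V) (Λ' : Module.Dual ℂ ℂ) (v' : ℂ) (b : Fˣ) (s' : ℂ) :
    rsZeta Nat.one_lt_two ν (tildeFn (whittakerModel π Λ (π (diagGL2 b 1) u)))
        (tildeFn (whittakerModel (glOneRep χ) Λ' v')) s' =
      ((χ b : ℂˣ) : ℂ)⁻¹ * (((normAbs F (b : F) : ℝ≥0) : ℝ) : ℂ) ^ (s' - 1 / 2) *
        rsZeta Nat.one_lt_two ν (tildeFn (whittakerModel π Λ u))
          (tildeFn (whittakerModel (glOneRep χ) Λ' v')) s' := by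
  rw [rsZeta_tildeFn_glOneRep, rsZeta_tildeFn_glOneRep]
  have hu : π (diagGL2 b 1) u =
      (π.comp (glTransposeInv (Fin 2) F).toMonoidHom) (diagGL2 b⁻¹ 1) u := by
    change π (diagGL2 b 1) u = π (glTransposeInv (Fin 2) F (diagGL2 b⁻¹ 1)) u
    rw [glTransposeInv_diagGL2_one, inv_inv]
  rw [hu, rsZeta_glOneRep_diagGL2 _ μ' ν hint, MonoidHom.inv_apply, map_inv, inv_inv,
    Units.val_inv_eq_inv_val, map_inv₀]
  have hb : (0 : ℝ) < ((normAbs F (b : F) : ℝ≥0) : ℝ) := by exact_mod_cast normAbs_units_pos b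
  rw [NNReal.coe_inv, Complex.ofReal_inv, Complex.inv_cpow _ _ ?_, ← Complex.cpow_neg, neg_neg]
  rw [Complex.arg_ofReal_of_nonneg hb.le]
  exact Real.pi_ne_zero.symm

omit [MeasurableSpace (GL (Fin 1) F ⧸ upperUnitriangular (Fin 1) F)] in
/-- **Absolute convergence of the torus zeta integral for `re s` large** (Jacquet–Langlands 1970,
Prop. 2.10): for `ρ` smooth with finite-dimensional Jacquet module, `Λ` a `ψ`-Whittaker functional
and `μ'` left invariant and finite on compacts, `a ↦ W_u(d(a,1)) κ |a|^{s-1/2}` is `μ'`-integrable for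
`re s > c(u)` — vanishing at infinity, the torus recursion from the characteristic polynomial of
`d(ϖ, 1)` on `V_N`, the gauge `‖W_u(d(a,1))‖ ≤ C 1_{𝔭^{k₁}}(a) |a|^{-N}`, and Tate's comparison.
[cite: JacquetLanglands1970, Prop. 2.10] -/
theorem exists_forall_integrable_whittakerModel_mul_cpow (ρ : Representation ℂ (GL (Fin 2) F) V)
    (hρ : ρ.IsSmooth) {ψ : AddChar F Circle} (hψ : ψ.IsContinuousNontrivial)
    [FiniteDimensional ℂ (Representation.restrictUnipotentGL F (id : Fin 2 → Fin 2) ρ).Coinvariants]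
    {Λ : Module.Dual ℂ V} (hΛ : Λ ∈ whittakerFunctionals ρ ψ) (μ' : Measure Fˣ)
    [IsFiniteMeasureOnCompacts μ'] [μ'.IsMulLeftInvariant] (u : V) (κ : ℂ) :
    ∃ c : ℝ, ∀ s : ℂ, c < s.re → Integrable (fun a : Fˣ => whittakerModel ρ Λ u (diagGL2 a 1) * κ *
      (((normAbs F (a : F) : ℝ≥0) : ℝ) : ℂ) ^ (s - 1 / 2)) μ' := by
  obtain ⟨ϖ₀, hϖ₀0, hϖ₀⟩ := exists_normAbs_eq_inv (F := F)
  set ϖ : Fˣ := Units.mk0 ϖ₀ hϖ₀0 with hϖ_def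
  have hϖ : normAbs F (ϖ : F) = (residueFieldCard F : ℝ≥0)⁻¹ := hϖ₀
  obtain ⟨Q, hQm, -, hQ⟩ := exists_monic_forall_sum_coeff_mul_whittakerModel_eq_zero ρ hψ ϖ ⊤
    (fun _ _ => Submodule.mem_top)
  have hcd : Q.coeff Q.natDegree = 1 := hQm.coeff_natDegree
  obtain ⟨kr, hkr⟩ := hQ hΛ u Submodule.mem_top
  obtain ⟨k₁, hk₁⟩ := exists_whittakerModel_diagGL2_eq_zero_of_not_mem ρ hψ hΛ (hρ u)
  have hcv : Continuous fun a : Fˣ => whittakerModel ρ Λ u (diagGL2 a 1) :=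
    (isLocallyConstant_whittakerModel_diagGL2 ρ Λ (hρ u)).continuous
  obtain ⟨C, N, hle⟩ := exists_norm_le_indicator_rpow_of_recursion hcv hk₁ hϖ
    (c := fun j => Q.coeff j) hcd hkr
  exact ⟨N + 1 / 2, fun s hs => integrable_mul_cpow_of_norm_le μ' hcv hle κ hs⟩

/-- **Additivity of `Ψ(s; W_u, χ)` in `u` for `re s` large** (both integrals converge absolutely):
for `π` smooth with finite-dimensional Jacquet module and `χ` with open kernel. [folklore] -/
theorem eventually_rsZeta_glOneRep_add (μ' : Measure Fˣ) [μ'.IsHaarMeasure]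
    (ν : Measure (GL (Fin 1) F ⧸ upperUnitriangular (Fin 1) F))
    (hint : ∀ f : GL (Fin 1) F ⧸ upperUnitriangular (Fin 1) F → ℂ,
      ∫ x, f x ∂ν = ∫ a : Fˣ, f (QuotientGroup.mk (glDiagonal 1 F fun _ => a)) ∂μ')
    (hπ : π.IsSmooth) {ψ : AddChar F Circle} (hψ : ψ.IsContinuousNontrivial)
    [FiniteDimensional ℂ (Representation.restrictUnipotentGL F (id : Fin 2 → Fin 2) π).Coinvariants]
    {Λ : Module.Dual ℂ V} (hΛ : Λ ∈ whittakerFunctionals π ψ) {χ : Fˣ →* ℂˣ}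
    (hχ : IsOpen (χ.ker : Set Fˣ)) (Λ' : Module.Dual ℂ ℂ) (v' : ℂ) (u₁ u₂ : V) :
    ∀ᶠ s in rightHalfPlanes,
      rsZeta Nat.one_lt_two ν (whittakerModel π Λ (u₁ + u₂)) (whittakerModel (glOneRep χ) Λ' v') s =
        rsZeta Nat.one_lt_two ν (whittakerModel π Λ u₁) (whittakerModel (glOneRep χ) Λ' v') s +
          rsZeta Nat.one_lt_two ν (whittakerModel π Λ u₂) (whittakerModel (glOneRep χ) Λ' v') s := by
  haveI : T2Space F :=
    (Literature.NumberTheory.GaloisRepresentations.IsNonarchimedeanLocalField.isLocalField F).toT2Space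
  haveI : BorelSpace Fˣ := Units.borelSpace
  -- the twist `π ⊗ (χ ∘ det)`: smooth, same Jacquet module, same Whittaker functionals
  set c : GL (Fin 2) F →* ℂˣ := χ.comp Matrix.GeneralLinearGroup.det with hc_def
  have hc : ∀ g, c g = χ (Matrix.GeneralLinearGroup.det g) := fun g => rfl
  have hπ' : (π.twist c).IsSmooth := hπ.twist (isOpen_ker_of_det hχ hc)
  have hΛ' : Λ ∈ whittakerFunctionals (π.twist c) ψ := by
    rw [whittakerFunctionals_twist_det π χ c hc]; exact hΛ
  have hJ := restrictUnipotentGL_twist_det π χ c hc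
  haveI : FiniteDimensional ℂ
      (Representation.restrictUnipotentGL F (id : Fin 2 → Fin 2) (π.twist c)).Coinvariants := by
    rw [hJ]; infer_instance
  have htw : ∀ (u : V) (a : Fˣ), ((χ a : ℂˣ) : ℂ) * whittakerModel π Λ u (diagGL2 a 1) =
      whittakerModel (π.twist c) Λ u (diagGL2 a 1) := fun u a => by
    rw [whittakerModel_twist_det π χ c hc, det_diagGL2_one_eq]
  obtain ⟨c₁, hc₁⟩ := exists_forall_integrable_whittakerModel_mul_cpow (π.twist c) hπ' hψ hΛ' μ' u₁ (Λ' v')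
  obtain ⟨c₂, hc₂⟩ := exists_forall_integrable_whittakerModel_mul_cpow (π.twist c) hπ' hψ hΛ' μ' u₂ (Λ' v')
  refine eventually_rightHalfPlanes_iff.2 ⟨max c₁ c₂, fun s hs => ?_⟩
  have h1 := hc₁ s ((le_max_left _ _).trans_lt hs)
  have h2 := hc₂ s ((le_max_right _ _).trans_lt hs)
  rw [rsZeta_glOneRep_eq_integral π μ' ν hint, rsZeta_glOneRep_eq_integral π μ' ν hint,
    rsZeta_glOneRep_eq_integral π μ' ν hint]
  simp_rw [htw] at h1 h2 ⊢
  rw [← integral_add h1 h2]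
  refine integral_congr_ae (Filter.Eventually.of_forall fun a => ?_)
  simp only [map_add, Pi.add_apply]
  ring

end Torus

/-! ### Part D: rational continuations as `ℂ(X)`-valued linear functionals -/

section Functional

/-- **Scalars evaluate exactly**: `(k R)(q^{-s}) = k · R(q^{-s})` for every `s` (also at the
poles, where both sides carry the junk value `0`). [folklore] -/
theorem evalAtQ_C_mul (q : ℕ) (k : ℂ) (R : RatFunc ℂ) (s : ℂ) :
    evalAtQ q (RatFunc.C k * R) s = k * evalAtQ q R s := by
  by_cases hk : k = 0
  · rw [hk, map_zero, zero_mul, zero_mul, evalAtQ, RatFunc.eval_zero]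
  set t : ℂ := (q : ℂ) ^ (-s) with ht
  by_cases hden : Polynomial.eval₂ (RingHom.id ℂ) t R.denom = 0
  · -- both sides vanish: `denom R ∣ denom (C k * R)` since `R = (C k)⁻¹ (C k R)`
    have h0 : evalAtQ q R s = 0 := RatFunc.eval_eq_zero_of_eval₂_denom_eq_zero hden
    have hdvd : R.denom ∣ (RatFunc.C k * R).denom := by
      have h := RatFunc.denom_mul_dvd (RatFunc.C k⁻¹) (RatFunc.C k * R)
      rwa [← mul_assoc, ← map_mul, inv_mul_cancel₀ hk, map_one, one_mul, RatFunc.denom_C, one_mul]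
        at h
    obtain ⟨c, hc⟩ := hdvd
    have hden' : Polynomial.eval₂ (RingHom.id ℂ) t (RatFunc.C k * R).denom = 0 := by
      rw [hc, Polynomial.eval₂_mul, hden, zero_mul]
    rw [h0, mul_zero, evalAtQ, RatFunc.eval_eq_zero_of_eval₂_denom_eq_zero hden']
  · have hC : Polynomial.eval₂ (RingHom.id ℂ) t (RatFunc.C k).denom ≠ 0 := by
      rw [RatFunc.denom_C, Polynomial.eval₂_one]; exact one_ne_zero
    rw [evalAtQ, RatFunc.eval_mul (RingHom.id ℂ) t hC hden, RatFunc.eval_C, RingHom.id_apply]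
    rfl

/-- `k · Z(s) = (k R)(q^{-s})` on the same right half-plane. [folklore] -/
theorem EqOnRightHalfPlane.const_mul {q : ℕ} {Z : ℂ → ℂ} {R : RatFunc ℂ}
    (h : EqOnRightHalfPlane q Z R) (k : ℂ) :
    EqOnRightHalfPlane q (fun s => k * Z s) (RatFunc.C k * R) := by
  obtain ⟨c, hc⟩ := h
  exact ⟨c, fun s hs => by dsimp only; rw [evalAtQ_C_mul, hc s hs]⟩

/-- `k · Z(s) = (k R)(q^{-s})` on the same left half-plane. [folklore] -/
theorem EqOnLeftHalfPlane.const_mul {q : ℕ} {Z : ℂ → ℂ} {R : RatFunc ℂ}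
    (h : EqOnLeftHalfPlane q Z R) (k : ℂ) :
    EqOnLeftHalfPlane q (fun s => k * Z s) (RatFunc.C k * R) := by
  obtain ⟨c, hc⟩ := h
  exact ⟨c, fun s hs => by dsimp only; rw [evalAtQ_C_mul, hc s hs]⟩

variable {V : Type*} [AddCommGroup V] [Module ℂ V]

/-- **Rational continuation is a linear functional.**  Let `Ψ_u(s)` (`u ∈ V`) be a family of
functions, additive and homogeneous in `u` for `re s` large, each agreeing with a rational
function of `q^{-s}` for `re s` large (`1 < q`).  Then `u ↦ R_u` IS a `ℂ`-linear map
`V → ℂ(X)` (identity principle `ratFunc_eq_of_eventually_evalAtQ_eq`). [folklore] -/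
theorem exists_linearMap_eqOnRightHalfPlane {q : ℕ} (hq : 1 < q) (Ψ : V → ℂ → ℂ)
    (hadd : ∀ u₁ u₂ : V, ∀ᶠ s in rightHalfPlanes, Ψ (u₁ + u₂) s = Ψ u₁ s + Ψ u₂ s)
    (hsmul : ∀ (c : ℂ) (u : V), ∀ᶠ s in rightHalfPlanes, Ψ (c • u) s = c * Ψ u s)
    (hR : ∀ u : V, ∃ R : RatFunc ℂ, EqOnRightHalfPlane q (Ψ u) R) :
    ∃ Z : V →ₗ[ℂ] RatFunc ℂ, ∀ u : V, EqOnRightHalfPlane q (Ψ u) (Z u) := by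
  choose R hR using hR
  refine ⟨{ toFun := R, map_add' := fun u₁ u₂ => ?_, map_smul' := fun c u => ?_ }, hR⟩
  · refine ratFunc_eq_of_eventually_evalAtQ_eq hq ?_
    filter_upwards [eqOnRightHalfPlane_iff.1 (hR (u₁ + u₂)), eqOnRightHalfPlane_iff.1 (hR u₁),
      eqOnRightHalfPlane_iff.1 (hR u₂), hadd u₁ u₂, eventually_evalAtQ_add hq (R u₁) (R u₂)]
      with s h0 h1 h2 h3 h4
    rw [← h0, h3, h1, h2, h4]
  · refine ratFunc_eq_of_eventually_evalAtQ_eq hq ?_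
    filter_upwards [eqOnRightHalfPlane_iff.1 (hR (c • u)), eqOnRightHalfPlane_iff.1 (hR u), hsmul c u]
      with s h0 h1 h3
    rw [RingHom.id_apply, ← h0, h3, h1, Algebra.smul_def, RatFunc.algebraMap_eq_C, evalAtQ_C_mul]

/-- `c X` is transcendental over `ℂ` in `ℂ(X)` for `c ≠ 0`. [folklore] -/
theorem ratFunc_transcendental_C_mul_X {c : ℂ} (hc : c ≠ 0) :
    Transcendental ℂ (RatFunc.C c * RatFunc.X : RatFunc ℂ) := by
  rintro ⟨p, hp0, hp⟩
  have h1 : (RatFunc.C c * RatFunc.X : RatFunc ℂ) = algebraMap ℂ[X] (RatFunc ℂ) (C c * X) := by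
    rw [map_mul, RatFunc.algebraMap_C, RatFunc.algebraMap_X]
  rw [h1, Polynomial.aeval_algebraMap_apply, map_eq_zero_iff _ (RatFunc.algebraMap_injective ℂ),
    ← Polynomial.comp_eq_aeval, Polynomial.comp_eq_zero_iff] at hp
  rcases hp with hp | ⟨-, hp⟩
  · exact hp0 hp
  · have h2 := congrArg natDegree hp
    rw [natDegree_C, natDegree_C_mul_X _ hc] at h2
    exact one_ne_zero h2

end Functional

/-! ### Part E: the functional equation for `π' = χ ∘ det` -/

section FE

variable {F : Type} [Field F] [ValuativeRel F] [TopologicalSpace F] [IsNonarchimedeanLocalField F]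
  {V : Type} [AddCommGroup V] [Module ℂ V] (π : Representation ℂ (GL (Fin 2) F) V)
  [MeasurableSpace F] [BorelSpace F]
  [MeasurableSpace (GL (Fin 1) F ⧸ upperUnitriangular (Fin 1) F)]
  [BorelSpace (GL (Fin 1) F ⧸ upperUnitriangular (Fin 1) F)]

omit [MeasurableSpace F] [BorelSpace F] [MeasurableSpace (GL (Fin 1) F ⧸ upperUnitriangular (Fin 1) F)]
  [BorelSpace (GL (Fin 1) F ⧸ upperUnitriangular (Fin 1) F)] in
/-- `|b|^z = (q^{-z})^k` for `|b| = q^{-k}`. [folklore] -/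
theorem normAbs_cpow_of_eq_zpow {b : Fˣ} {k : ℤ}
    (hk : normAbs F (b : F) = (residueFieldCard F : ℝ≥0)⁻¹ ^ k) (z : ℂ) :
    (((normAbs F (b : F) : ℝ≥0) : ℝ) : ℂ) ^ z = ((residueFieldCard F : ℂ) ^ (-z)) ^ k := by
  have hq0 : (0 : ℝ) < (residueFieldCard F : ℝ) := by
    exact_mod_cast (zero_lt_one.trans (one_lt_residueFieldCard F))
  rw [hk, NNReal.coe_zpow, NNReal.coe_inv, NNReal.coe_natCast, ofReal_zpow_cpow (inv_pos.2 hq0),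
    Complex.ofReal_inv, Complex.ofReal_natCast, Complex.inv_cpow _ _ ?_, Complex.cpow_neg]
  rw [Complex.natCast_arg]
  exact Real.pi_ne_zero.symm

omit [ValuativeRel F] [TopologicalSpace F] [IsNonarchimedeanLocalField F]
  [MeasurableSpace (GL (Fin 1) F ⧸ upperUnitriangular (Fin 1) F)]
  [BorelSpace (GL (Fin 1) F ⧸ upperUnitriangular (Fin 1) F)] [MeasurableSpace F] [BorelSpace F] in
/-- The kernel of `χ⁻¹` is the kernel of `χ`. [folklore] -/
theorem monoidHom_ker_inv_eq (χ : Fˣ →* ℂˣ) : (χ⁻¹).ker = χ.ker := by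
  ext x
  simp [MonoidHom.mem_ker]

/-- **The `GL₂ × GL₁` local functional equation, core statement** (Jacquet–Langlands 1970,
Thm. 2.18 (iv); Jacquet–Piatetski-Shapiro–Shalika 1983, Thm. 2.7 (iii) for `(n, m) = (2, 1)`).
Let `π` be an irreducible smooth `ψ`-generic representation of `GL₂(F)` (`V : Type`), `Λ ≠ 0` a
`ψ`-Whittaker functional, `χ` a character of `Fˣ` with open kernel and `ν` an invariant measure on
`GL₁(F) ⧸ U₁`.  There is `γ ∈ ℂ(X)` such that for every `u ∈ V` the zeta integral
`Ψ(s; W_u, χ)` and the contragredient integral `Ψ(1 - s; W̃_u, χ̃)` are (for `re s` large, resp.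
small) the values at `q^{-s}` of rational functions `R_u`, `R̃_u` with `R̃_u = γ R_u`.
Proof: `u ↦ R_u` and `u ↦ R̃_u` (the latter through the substitution `X ↦ q⁻¹X⁻¹`,
`dualSubst`) are `ℂ`-linear maps `V → ℂ(X)` transforming under `π(d(b, 1))` by the same character
`e(b) = χ(b)⁻¹ |b|^{1/2 - s}` (`rsZeta_glOneRep_diagGL2`, `rsZeta_tildeFn_glOneRep_diagGL2`), so
they are proportional (`torusEquivariant_proportional`, `GL2TorusEquivariantUniqueness`), and
`R_w ≠ 0` for the test vector `w` (its zeta integral is the constant `μ'(U^M) ≠ 0`).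
[cite: JacquetLanglands1970, Thm. 2.18 (iv)] [cite: JacquetPiatetskiShapiroShalika1983, Thm. 2.7 (iii)] -/
theorem exists_gamma_glOneRep_whittakerModel_id [π.IsIrreducible] (hπ : π.IsSmooth)
    {ψ : AddChar F Circle} (hψ : ψ.IsContinuousNontrivial) {Λ : Module.Dual ℂ V}
    (hΛ : Λ ∈ whittakerFunctionals π ψ) (hΛ0 : Λ ≠ 0) {χ : Fˣ →* ℂˣ} (hχ : IsOpen (χ.ker : Set Fˣ))
    (ν : Measure (GL (Fin 1) F ⧸ upperUnitriangular (Fin 1) F))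
    [SMulInvariantMeasure (GL (Fin 1) F) (GL (Fin 1) F ⧸ upperUnitriangular (Fin 1) F) ν]
    [IsFiniteMeasureOnCompacts ν] [ν.IsOpenPosMeasure] :
    ∃ γ : RatFunc ℂ, ∀ u : V, ∃ R Rt : RatFunc ℂ,
      EqOnRightHalfPlane (residueFieldCard F)
        (rsZeta Nat.one_lt_two ν (whittakerModel π Λ u) (whittakerModel (glOneRep χ) LinearMap.id 1)) R ∧
      EqOnLeftHalfPlane (residueFieldCard F)
        (fun s => rsZeta Nat.one_lt_two ν (tildeFn (whittakerModel π Λ u))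
          (tildeFn (whittakerModel (glOneRep χ) LinearMap.id 1)) (1 - s)) Rt ∧
      Rt = γ * R := by
  classical
  haveI : T2Space F :=
    (Literature.NumberTheory.GaloisRepresentations.IsNonarchimedeanLocalField.isLocalField F).toT2Space
  haveI : BorelSpace Fˣ := Units.borelSpace
  set q : ℕ := residueFieldCard F with hq_def
  have hq : 1 < q := one_lt_residueFieldCard F
  have hq0 : q ≠ 0 := by omega
  have hqC : (q : ℂ) ≠ 0 := Nat.cast_ne_zero.2 hq0
  obtain ⟨μ', hμ', hint⟩ := exists_isHaarMeasure_integral_eq ν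
  haveI := hμ'
  -- finite-dimensional Jacquet modules of `π` and of the twist `π^ι`
  let πv : SmoothIrrep (GL (Fin 2) F) :=
    { V := V, ρ := π, isIrreducible := inferInstance, isSmooth := hπ }
  haveI := (finiteDimensional_coinvariants_smoothIrrep_fin_two πv).1
  set πι : Representation ℂ (GL (Fin 2) F) V := π.comp (glTransposeInv (Fin 2) F).toMonoidHom
    with hπι_def
  haveI hirrι : πι.IsIrreducible := (isIrreducible_twist_iff (π := π)).2 inferInstance
  have hπι : πι.IsSmooth := isSmooth_twist hπ
  let πιv : SmoothIrrep (GL (Fin 2) F) :=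
    { V := V, ρ := πι, isIrreducible := hirrι, isSmooth := hπι }
  haveI := (finiteDimensional_coinvariants_smoothIrrep_fin_two πιv).1
  set Λι : Module.Dual ℂ V := Λ.comp (π (weylLong 2 F)) with hΛι_def
  have hΛι : Λι ∈ whittakerFunctionals πι ψ⁻¹ := comp_weylLong_mem_whittakerFunctionals_twist hΛ
  have hψι : ψ⁻¹.IsContinuousNontrivial := hψ.inv
  have hχι : IsOpen ((χ⁻¹).ker : Set Fˣ) := by rw [monoidHom_ker_inv_eq]; exact hχ
  have hgen : IsGeneric π ψ := (isGeneric_iff π ψ).2 ⟨Λ, hΛ, hΛ0⟩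
  have hgenι : IsGeneric πι ψ⁻¹ := IsGeneric.twist hgen
  -- the `L`-polynomials of `(π, χ)` and `(π^ι, χ⁻¹)`: rational continuations exist
  obtain ⟨P, hP, -⟩ := exists_hasRSLFactor_glOneRep π hπ hψ hgen hχ ν
  obtain ⟨P', hP', -⟩ := exists_hasRSLFactor_glOneRep πι hπι hψι hgenι hχι ν
  have hmem : (LinearMap.id : Module.Dual ℂ ℂ) ∈ whittakerFunctionals (glOneRep χ) ψ⁻¹ := by
    rw [whittakerFunctionals_eq_top_of_fin_one]; trivial
  have hmemι : (LinearMap.id : Module.Dual ℂ ℂ) ∈ whittakerFunctionals (glOneRep χ⁻¹) ψ⁻¹⁻¹ := by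
    rw [whittakerFunctionals_eq_top_of_fin_one]; trivial
  -- the right functional `Zr`
  obtain ⟨Zr, hZr⟩ := exists_linearMap_eqOnRightHalfPlane hq
    (fun u s => rsZeta Nat.one_lt_two ν (whittakerModel π Λ u) (whittakerModel (glOneRep χ) LinearMap.id 1) s)
    (fun u₁ u₂ => eventually_rsZeta_glOneRep_add π μ' ν hint hπ hψ hΛ hχ LinearMap.id 1 u₁ u₂)
    (fun c u => Filter.Eventually.of_forall fun s =>
      rsZeta_glOneRep_smul π μ' ν hint χ Λ c u LinearMap.id 1 s)
    (fun u => by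
      obtain ⟨R, -, hR⟩ := hP.2.1 Λ hΛ LinearMap.id hmem u 1
      exact ⟨_, hR⟩)
  -- the contragredient functional `Zr'` (variable `q^{-s'}`) and `Zt = σ ∘ Zr'` (variable `q^{-s}`)
  obtain ⟨Zr', hZr'⟩ := exists_linearMap_eqOnRightHalfPlane hq
    (fun u s => rsZeta Nat.one_lt_two ν (whittakerModel πι Λι u)
      (whittakerModel (glOneRep χ⁻¹) LinearMap.id 1) s)
    (fun u₁ u₂ => eventually_rsZeta_glOneRep_add πι μ' ν hint hπι hψι hΛι hχι LinearMap.id 1 u₁ u₂)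
    (fun c u => Filter.Eventually.of_forall fun s =>
      rsZeta_glOneRep_smul πι μ' ν hint χ⁻¹ Λι c u LinearMap.id 1 s)
    (fun u => by
      obtain ⟨R, -, hR⟩ := hP'.2.1 Λι hΛι LinearMap.id hmemι u 1
      exact ⟨_, hR⟩)
  set Zt : V →ₗ[ℂ] RatFunc ℂ := (dualSubst F).toLinearMap.comp Zr' with hZt_def
  have hZt_apply : ∀ u, Zt u = dualSubst F (Zr' u) := fun u => rfl
  have hZt : ∀ u, EqOnLeftHalfPlane q
      (fun s => rsZeta Nat.one_lt_two ν (tildeFn (whittakerModel π Λ u))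
        (tildeFn (whittakerModel (glOneRep χ) LinearMap.id 1)) (1 - s)) (Zt u) := by
    intro u
    have h := eqOnLeftHalfPlane_one_sub_dualSubst F (hZr' u)
    simp only [rsZeta_tildeFn_glOneRep]
    exact h
  -- the character `e(b) = χ(b)⁻¹ α^{k} X^{-k}`, `|b| = q^{-k}`, `α = q^{-1/2}`
  set α : ℂ := (q : ℂ) ^ (-(1 / 2 : ℂ)) with hα_def
  have hα0 : α ≠ 0 := by rw [hα_def, Ne, Complex.cpow_eq_zero_iff, not_and_or]; exact Or.inl hqC
  have hαα : α * α = ((q : ℂ))⁻¹ := by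
    rw [hα_def, ← Complex.cpow_add _ _ hqC, show -(1 / 2 : ℂ) + -(1 / 2) = -1 by ring,
      Complex.cpow_neg_one]
  have hk : ∀ b : Fˣ, ∃ k : ℤ, normAbs F (b : F) = (residueFieldCard F : ℝ≥0)⁻¹ ^ k :=
    fun b => exists_normAbs_eq_inv_zpow b.ne_zero
  choose ord hord using hk
  have hord_eq : ∀ (b : Fˣ) (k : ℤ), normAbs F (b : F) = (residueFieldCard F : ℝ≥0)⁻¹ ^ k → ord b = k := by
    intro b k h
    have h1 := (hord b).symm.trans h
    exact le_antisymm (inv_residueFieldCard_zpow_le_iff.1 h1.symm.le) (inv_residueFieldCard_zpow_le_iff.1 h1.le)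
  set e : Fˣ → RatFunc ℂ := fun b => tateEpsilonRat (((χ b : ℂˣ) : ℂ)⁻¹ * α ^ ord b) (-ord b)
    with he_def
  -- evaluation of `e` and of its contragredient partner
  have heval : ∀ (b : Fˣ) (s : ℂ),
      ((χ b : ℂˣ) : ℂ)⁻¹ * (((normAbs F (b : F) : ℝ≥0) : ℝ) : ℂ) ^ (-(s - 1 / 2)) = evalAtQ q (e b) s := by
    intro b s
    rw [he_def, evalAtQ_tateEpsilonRat hq0, normAbs_cpow_of_eq_zpow (hord b), neg_neg,
      show s - 1 / 2 = s + -(1 / 2 : ℂ) by ring, Complex.cpow_add _ _ hqC, ← hα_def, mul_zpow,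
      show (q : ℂ) ^ s = ((q : ℂ) ^ (-s))⁻¹ by rw [Complex.cpow_neg, inv_inv], inv_zpow']
    ring
  have heval' : ∀ (b : Fˣ) (s : ℂ),
      ((χ b : ℂˣ) : ℂ)⁻¹ * (((normAbs F (b : F) : ℝ≥0) : ℝ) : ℂ) ^ (s - 1 / 2) =
        evalAtQ q (tateEpsilonRat (((χ b : ℂˣ) : ℂ)⁻¹ * α ^ (-ord b)) (ord b)) s := by
    intro b s
    rw [evalAtQ_tateEpsilonRat hq0, normAbs_cpow_of_eq_zpow (hord b),
      show -(s - 1 / 2) = -s + (1 / 2 : ℂ) by ring, Complex.cpow_add _ _ hqC,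
      show (q : ℂ) ^ (1 / 2 : ℂ) = α⁻¹ by rw [hα_def, Complex.cpow_neg, inv_inv], mul_zpow, inv_zpow']
    ring
  have hσe : ∀ b : Fˣ,
      dualSubst F (tateEpsilonRat (((χ b : ℂˣ) : ℂ)⁻¹ * α ^ (-ord b)) (ord b)) = e b := by
    intro b
    rw [dualSubst_tateEpsilonRat, he_def]
    simp only
    congr 1
    rw [← hαα, mul_zpow, mul_assoc, ← zpow_add₀ hα0, ← zpow_add₀ hα0]
    congr 2
    ring
  -- equivariance of `Zr` and `Zt`
  have hZr_eq : ∀ (b : Fˣ) (u : V), Zr (π (diagGL2 b 1) u) = e b * Zr u := by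
    intro b u
    refine ratFunc_eq_of_eventually_evalAtQ_eq hq ?_
    filter_upwards [eqOnRightHalfPlane_iff.1 (hZr (π (diagGL2 b 1) u)), eqOnRightHalfPlane_iff.1 (hZr u),
      eventually_evalAtQ_mul hq (e b) (Zr u)] with s h1 h2 h3
    rw [← h1, h3, ← h2, ← heval b s]
    exact rsZeta_glOneRep_diagGL2 π μ' ν hint χ Λ u LinearMap.id 1 b s
  have hZr'_eq : ∀ (b : Fˣ) (u : V), Zr' (π (diagGL2 b 1) u) =
      tateEpsilonRat (((χ b : ℂˣ) : ℂ)⁻¹ * α ^ (-ord b)) (ord b) * Zr' u := by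
    intro b u
    refine ratFunc_eq_of_eventually_evalAtQ_eq hq ?_
    filter_upwards [eqOnRightHalfPlane_iff.1 (hZr' (π (diagGL2 b 1) u)), eqOnRightHalfPlane_iff.1 (hZr' u),
      eventually_evalAtQ_mul hq (tateEpsilonRat (((χ b : ℂˣ) : ℂ)⁻¹ * α ^ (-ord b)) (ord b)) (Zr' u)]
      with s h1 h2 h3
    rw [← h1, h3, ← h2, ← heval' b s]
    have h := rsZeta_tildeFn_glOneRep_diagGL2 π μ' ν hint χ Λ u LinearMap.id 1 b s
    simp only [rsZeta_tildeFn_glOneRep] at h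
    exact h
  have hZt_eq : ∀ (b : Fˣ) (u : V), Zt (π (diagGL2 b 1) u) = e b * Zt u := by
    intro b u
    rw [hZt_apply, hZt_apply, hZr'_eq, map_mul, hσe]
  -- `e = 1` on a deep `U^f`, and `e(ϖ⁻¹)` is transcendental
  obtain ⟨f, -, hf⟩ := exists_unitFiltration_subset (hχ.mem_nhds χ.ker.one_mem)
  have he1 : ∀ u ∈ unitFiltration F f, e u = 1 := by
    intro u hu
    have hχu : χ u = 1 := hf hu
    have hou : ord u = 0 := hord_eq u 0 (by rw [zpow_zero]; exact hu.1)
    rw [he_def]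
    simp only [hχu, hou, Units.val_one, inv_one, zpow_zero, mul_one, neg_zero]
    rw [tateEpsilonRat, map_one, zpow_zero, mul_one]
  obtain ⟨ϖ₀, hϖ₀0, hϖ₀⟩ := exists_normAbs_eq_inv (F := F)
  set t : Fˣ := (Units.mk0 ϖ₀ hϖ₀0)⁻¹ with ht_def
  have hot : ord t = -1 := hord_eq t (-1) (by
    rw [ht_def, Units.val_inv_eq_inv_val, Units.val_mk0, map_inv₀, hϖ₀, zpow_neg, zpow_one])
  have het : Transcendental ℂ (e t) := by
    have h1 : e t = RatFunc.C (((χ t : ℂˣ) : ℂ)⁻¹ * α ^ (-1 : ℤ)) * RatFunc.X := by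
      rw [he_def]
      simp only [hot, neg_neg]
      rw [tateEpsilonRat, zpow_one]
    rw [h1]
    exact ratFunc_transcendental_C_mul_X (mul_ne_zero (inv_ne_zero (Units.ne_zero _)) (zpow_ne_zero _ hα0))
  -- the uniqueness principle
  obtain ⟨w, M, hfM, h1M, hw, hprop⟩ :=
    torusEquivariant_proportional π hπ hψ hΛ hΛ0 (K := RatFunc ℂ) he1 het
  -- `Zr w = μ'(U^M) ≠ 0`
  have hΨw : ∀ s : ℂ, rsZeta Nat.one_lt_two ν (whittakerModel π Λ w)
      (whittakerModel (glOneRep χ) LinearMap.id 1) s = (μ'.real (unitFiltration F M) : ℂ) := by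
    intro s
    rw [rsZeta_glOneRep_eq_integral π μ' ν hint]
    have hfun : (fun a : Fˣ => ((χ a : ℂˣ) : ℂ) * whittakerModel π Λ w (diagGL2 a 1) *
        (LinearMap.id : Module.Dual ℂ ℂ) 1 *
        (((normAbs F (a : F) : ℝ≥0) : ℝ) : ℂ) ^ (s - 1 / 2)) =
        (unitFiltration F M).indicator fun _ => (1 : ℂ) := by
      funext a
      rw [hw a]
      by_cases ha : a ∈ unitFiltration F M
      · have hχa : χ a = 1 := hf (unitFiltration_antitone hfM ha)
        rw [Set.indicator_of_mem ha, hχa, ha.1, LinearMap.id_apply]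
        simp
      · rw [Set.indicator_of_notMem ha, mul_zero, zero_mul, zero_mul]
    rw [hfun, integral_indicator (measurableSet_unitFiltration h1M), setIntegral_const, Complex.real_smul,
      mul_one]
  have hZrw : Zr w = RatFunc.C (μ'.real (unitFiltration F M) : ℂ) :=
    EqOnRightHalfPlane.unique hq (hZr w) ⟨0, fun s _ => by dsimp only; rw [evalAtQ_C, hΨw s]⟩
  have hZrw0 : Zr w ≠ 0 := by
    rw [hZrw, Ne, map_eq_zero]
    exact Complex.ofReal_ne_zero.2 (measureReal_unitFiltration_ne_zero μ' h1M)
  -- conclusion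
  refine ⟨Zt w / Zr w, fun u => ⟨Zr u, Zt u, hZr u, hZt u, ?_⟩⟩
  have h := hprop Zr Zt hZr_eq hZt_eq u
  field_simp
  rw [mul_comm, ← h, mul_comm]

end FE

/-! ### Part F: `HasRSGamma` for `π' = χ ∘ det`, and for every irreducible admissible `π'` -/

section Gamma

variable {F : Type} [Field F] [ValuativeRel F] [TopologicalSpace F] [IsNonarchimedeanLocalField F]
  {V : Type} [AddCommGroup V] [Module ℂ V] (π : Representation ℂ (GL (Fin 2) F) V)

omit [ValuativeRel F] [IsNonarchimedeanLocalField F] in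
/-- **Whittaker functionals are proportional** (local multiplicity one,
`rank_whittakerFunctionals_le_one_holds`): for `π` irreducible smooth, `ψ` continuous non-trivial
and `Λ₀ ≠ 0` a `ψ`-Whittaker functional, every `ψ`-Whittaker functional is `c Λ₀`.
[cite: GelfandKazhdan1975, Thm. C] -/
theorem exists_eq_smul_of_mem_whittakerFunctionals {n : ℕ} {W : Type*} [AddCommGroup W] [Module ℂ W]
    [ValuativeRel F] [IsNonarchimedeanLocalField F]
    (ρ : Representation ℂ (GL (Fin n) F) W) [ρ.IsIrreducible] (hρ : ρ.IsSmooth)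
    {ψ : AddChar F Circle} (hψ : ψ.IsContinuousNontrivial) {Λ₀ Λ : Module.Dual ℂ W}
    (hΛ₀ : Λ₀ ∈ whittakerFunctionals ρ ψ) (hΛ₀0 : Λ₀ ≠ 0) (hΛ : Λ ∈ whittakerFunctionals ρ ψ) :
    ∃ c : ℂ, Λ = c • Λ₀ := by
  have hrank := rank_whittakerFunctionals_le_one_holds ρ ψ hρ hψ
  obtain ⟨v₀, -, hle⟩ := (rank_submodule_le_one_iff _).1 hrank
  obtain ⟨c₁, hc₁⟩ := Submodule.mem_span_singleton.1 (hle hΛ₀)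
  obtain ⟨c₂, hc₂⟩ := Submodule.mem_span_singleton.1 (hle hΛ)
  have hc₁0 : c₁ ≠ 0 := by
    rintro rfl
    rw [zero_smul] at hc₁
    exact hΛ₀0 hc₁.symm
  refine ⟨c₂ * c₁⁻¹, ?_⟩
  rw [← hc₂, ← hc₁, smul_smul, mul_assoc, inv_mul_cancel₀ hc₁0, mul_one]

variable [MeasurableSpace F] [BorelSpace F]
  [MeasurableSpace (GL (Fin 1) F ⧸ upperUnitriangular (Fin 1) F)]
  [BorelSpace (GL (Fin 1) F ⧸ upperUnitriangular (Fin 1) F)]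

/-- **The local functional equation of `GL₂ × GL₁` for `π' = χ ∘ det`** (Jacquet–Langlands 1970,
Thm. 2.18 (iv); JPSS 1983, Thm. 2.7 (iii)): for `π` irreducible smooth `ψ`-generic (`V : Type`),
`χ` with open kernel, `ν` an invariant measure on `GL₁(F) ⧸ U₁` and ANY measure `μ` on `F` (it only
enters `Ψ_{n-m-1} = Ψ_0`, `rsZetaTilde_two_one`), some `γ ∈ ℂ(X)` has
`HasRSGamma (1<2) π (glOneRep χ) ψ μ ν γ` — i.e. `Ψ(1 - s; W̃, χ̃) = χ(-1) γ(q^{-s}) Ψ(s; W, χ)` for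
all Whittaker data, read in `ℂ(q^{-s})` (the data scale through `Λ = c Λ₀`, `Λ'(v')`).
[cite: JacquetLanglands1970, Thm. 2.18 (iv)] [cite: JacquetPiatetskiShapiroShalika1983, Thm. 2.7 (iii)] -/
theorem exists_hasRSGamma_glOneRep [π.IsIrreducible] (hπ : π.IsSmooth) {ψ : AddChar F Circle}
    (hψ : ψ.IsContinuousNontrivial) (hg : IsGeneric π ψ) {χ : Fˣ →* ℂˣ}
    (hχ : IsOpen (χ.ker : Set Fˣ)) (μ : Measure F)
    (ν : Measure (GL (Fin 1) F ⧸ upperUnitriangular (Fin 1) F))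
    [SMulInvariantMeasure (GL (Fin 1) F) (GL (Fin 1) F ⧸ upperUnitriangular (Fin 1) F) ν]
    [IsFiniteMeasureOnCompacts ν] [ν.IsOpenPosMeasure] :
    ∃ γ : RatFunc ℂ, HasRSGamma Nat.one_lt_two π (glOneRep χ) ψ μ ν γ := by
  obtain ⟨Λ₀, hΛ₀, hΛ₀0⟩ := (isGeneric_iff π ψ).1 hg
  obtain ⟨γ, hγ⟩ := exists_gamma_glOneRep_whittakerModel_id π hπ hψ hΛ₀ hΛ₀0 hχ ν
  obtain ⟨μ', hμ', hint⟩ := exists_isHaarMeasure_integral_eq ν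
  haveI := hμ'
  have hC : RatFunc.C ((χ (-1) : ℂˣ) : ℂ) ≠ 0 := (_root_.map_ne_zero RatFunc.C).mpr (Units.ne_zero _)
  refine ⟨(RatFunc.C ((χ (-1) : ℂˣ) : ℂ))⁻¹ * γ, glOneCentralChar χ, glOneRep_hasCentralCharacter χ,
    fun Λ hΛ Λ' _ u v' => ?_⟩
  obtain ⟨c, rfl⟩ := exists_eq_smul_of_mem_whittakerFunctionals π hπ hψ hΛ₀ hΛ₀0 hΛ
  obtain ⟨R, Rt, hR, hRt, hrel⟩ := hγ u
  set k : ℂ := c * Λ' v' with hk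
  refine ⟨RatFunc.C k * R, RatFunc.C k * Rt, ?_, ?_, ?_⟩
  · have h1 : rsZeta Nat.one_lt_two ν (whittakerModel π (c • Λ₀) u) (whittakerModel (glOneRep χ) Λ' v') =
        fun s => k * rsZeta Nat.one_lt_two ν (whittakerModel π Λ₀ u)
          (whittakerModel (glOneRep χ) LinearMap.id 1) s := by
      funext s
      rw [rsZeta_glOneRep_smul_functional π μ' ν hint, rsZeta_glOneRep_eq_mul_rsZeta_id π μ' ν hint χ Λ₀,
        hk, mul_assoc]
    rw [h1]
    exact hR.const_mul k
  · have h2 : (fun s => rsZetaTilde Nat.one_lt_two μ ν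
        (fun g => tildeFn (whittakerModel π (c • Λ₀) u) (g * weylNM F (Nat.one_lt_two).le))
        (tildeFn (whittakerModel (glOneRep χ) Λ' v')) (1 - s)) =
        fun s => k * rsZeta Nat.one_lt_two ν (tildeFn (whittakerModel π Λ₀ u))
          (tildeFn (whittakerModel (glOneRep χ) LinearMap.id 1)) (1 - s) := by
      funext s
      simp only [weylNM_one_two, mul_one, rsZetaTilde_two_one]
      rw [rsZeta_tildeFn_glOneRep, rsZeta_tildeFn_glOneRep, LinearMap.smul_comp,
        rsZeta_glOneRep_smul_functional _ μ' ν hint,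
        rsZeta_glOneRep_eq_mul_rsZeta_id _ μ' ν hint χ⁻¹ (Λ₀.comp (π (weylLong 2 F))), hk, mul_assoc]
    rw [h2]
    exact hRt.const_mul k
  · rw [hrel, glOneCentralChar_centerNegOne, show (2 - 1 : ℕ) = 1 from rfl, pow_one]
    field_simp

/-- **`∃! γ(s, π × χ, ψ)`** for `π` irreducible smooth generic (`V : Type`) and `χ` with open
kernel: the `(2, 1)`-instance of JPSS 1983, Thm. 2.7 (iii) with `π' = glOneRep χ` (uniqueness by
`HasRSGamma.existsUnique_of_exists` and the `L`-polynomial `exists_hasRSLFactor_glOneRep`).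
[cite: JacquetPiatetskiShapiroShalika1983, Thm. 2.7 (iii)] -/
theorem existsUnique_hasRSGamma_glOneRep [π.IsIrreducible] (hπ : π.IsSmooth) {ψ : AddChar F Circle}
    (hψ : ψ.IsContinuousNontrivial) (hg : IsGeneric π ψ) {χ : Fˣ →* ℂˣ}
    (hχ : IsOpen (χ.ker : Set Fˣ)) (μ : Measure F)
    (ν : Measure (GL (Fin 1) F ⧸ upperUnitriangular (Fin 1) F))
    [SMulInvariantMeasure (GL (Fin 1) F) (GL (Fin 1) F ⧸ upperUnitriangular (Fin 1) F) ν]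
    [IsFiniteMeasureOnCompacts ν] [ν.IsOpenPosMeasure] :
    ∃! γ : RatFunc ℂ, HasRSGamma Nat.one_lt_two π (glOneRep χ) ψ μ ν γ := by
  let πv : SmoothIrrep (GL (Fin 2) F) :=
    { V := V, ρ := π, isIrreducible := inferInstance, isSmooth := hπ }
  haveI := (finiteDimensional_coinvariants_smoothIrrep_fin_two πv).1
  obtain ⟨P, hP, -⟩ := exists_hasRSLFactor_glOneRep π hπ hψ hg hχ ν
  exact HasRSGamma.existsUnique_of_exists hP (exists_hasRSGamma_glOneRep π hπ hψ hg hχ μ ν)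

/-- **Jacquet–Piatetski-Shapiro–Shalika 1983, Thm. 2.7 (iii) for `GL₂ × GL₁`** — the literal
`(n, m) = (2, 1)` instance of the named fact `existsUnique_hasRSGamma_haar` (`RankinSelbergLocal`):
for `π` on `V : Type` and `π'` on `V' : Type` irreducible admissible generic, `ψ` continuous
non-trivial, `ν` invariant Radon of full support on `GL₁(F) ⧸ U₁` and `μ` additive Haar,
`∃! γ ∈ ℂ(q^{-s})` with `HasRSGamma (1<2) π π' ψ μ ν γ` (Jacquet–Langlands 1970, Thm. 2.18 (iv):
`Ψ̃(1-s; W̃, χ̃)/L(1-s, χ⁻¹ ⊗ π̃) = ε(s) Ψ(s; W, χ)/L(s, χ ⊗ π)`).  `π'` is a line on which `GL₁`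
acts by a quasi-character `χ` (`SmoothIrrep.existsUnique_quasiChar`), `HasRSGamma` transports
along `π' ≃ glOneRep χ` (`hasRSGamma_iff_of_equiv_right`), and `existsUnique_hasRSGamma_glOneRep`
applies. [cite: JacquetPiatetskiShapiroShalika1983, Thm. 2.7 (iii)]
[cite: JacquetLanglands1970, Thm. 2.18 (iv)] -/
theorem existsUnique_hasRSGamma_haar_two_one {V' : Type} [AddCommGroup V'] [Module ℂ V']
    (π' : Representation ℂ (GL (Fin 1) F) V') (ψ : AddChar F Circle)
    (ν : Measure (GL (Fin 1) F ⧸ upperUnitriangular (Fin 1) F))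
    [SMulInvariantMeasure (GL (Fin 1) F) (GL (Fin 1) F ⧸ upperUnitriangular (Fin 1) F) ν]
    [IsFiniteMeasureOnCompacts ν] [ν.IsOpenPosMeasure] (μ : Measure F) [μ.IsAddHaarMeasure] :
    existsUnique_hasRSGamma_haar Nat.one_lt_two π π' ψ ν μ := by
  intro hirr hirr' hπ hπ' hg _ hψ
  let π'v : SmoothIrrep (GL (Fin 1) F) :=
    { V := V', ρ := π', isIrreducible := hirr', isSmooth := hπ'.isSmooth }
  obtain ⟨χ, hχ, -⟩ := π'v.existsUnique_quasiChar
  have hχ' : ∀ (g : GL (Fin 1) F) (v : (SmoothIrrep.ofQuasiChar χ).V),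
      (SmoothIrrep.ofQuasiChar χ).ρ g v = ((χ (Matrix.GeneralLinearGroup.det g) : ℂˣ) : ℂ) • v :=
    fun g v => rfl
  obtain ⟨e'⟩ := SmoothIrrep.nonempty_equiv_of_quasiChar (π := π'v) (π' := SmoothIrrep.ofQuasiChar χ) hχ hχ'
  have key : ∀ γ : RatFunc ℂ, HasRSGamma Nat.one_lt_two π π' ψ μ ν γ ↔
      HasRSGamma Nat.one_lt_two π (glOneRep (χ : Fˣ →* ℂˣ)) ψ μ ν γ :=
    fun γ => hasRSGamma_iff_of_equiv_right e' γ
  simp only [key]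
  exact existsUnique_hasRSGamma_glOneRep π hπ.isSmooth hψ hg (isOpen_ker_quasiChar_holds χ) μ ν

/-- The same statement for bundled irreducible smooth representations (`SmoothIrrep`), with
admissibility of `π` not needed: `∃! γ` with `HasRSGamma (1<2) π (glOneRep χ) ψ μ ν γ` for every
quasi-character `χ`. [cite: JacquetPiatetskiShapiroShalika1983, Thm. 2.7 (iii)] -/
theorem existsUnique_hasRSGamma_smoothIrrep_quasiChar (πv : SmoothIrrep (GL (Fin 2) F))
    {ψ : AddChar F Circle} (hψ : ψ.IsContinuousNontrivial) (hg : IsGeneric πv.ρ ψ) (χ : QuasiChar F)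
    (μ : Measure F) (ν : Measure (GL (Fin 1) F ⧸ upperUnitriangular (Fin 1) F))
    [SMulInvariantMeasure (GL (Fin 1) F) (GL (Fin 1) F ⧸ upperUnitriangular (Fin 1) F) ν]
    [IsFiniteMeasureOnCompacts ν] [ν.IsOpenPosMeasure] :
    ∃! γ : RatFunc ℂ, HasRSGamma Nat.one_lt_two πv.ρ (glOneRep (χ : Fˣ →* ℂˣ)) ψ μ ν γ := by
  haveI := πv.isIrreducible
  exact existsUnique_hasRSGamma_glOneRep πv.ρ πv.isSmooth hψ hg (isOpen_ker_quasiChar_holds χ) μ ν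

end Gamma

end Literature.NumberTheory.Automorphic

end
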